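import Mathlib
import Literature.Analysis.FluidPDE.VectorCalculus
import Literature.Analysis.FluidPDE.VortexFilament.CurlEnergy
import Summits.NavierStokesRegularity.NavierStokesRegularity.Theorems.FilamentSkeletonRssSkeletonEquilibriumLineBiotSavart
import Summits.NavierStokesRegularity.NavierStokesRegularity.Theorems.FilamentSkeletonRssSelectionBoxRJRungStraightSkewTools

/-!
# Route `FilamentSkeletonRss` · crux `SelectionBoxRJ` (stmt-NavierStokesRegularity-21220) — rung 0: the straight-skew
(`Γ → ∞`) limit of the 2-filament ball skeleton of record, in the box's own vocabulary

Lane `ns-filament-19175-p1` (g5), director-ns g9 ORDER OF WORK l.3062 (B)(iii) / tribunal-ns J r1 feedback (1)–(2)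
(T3-ABSENT on the deciding crux `SelectionBoxRJ`).  Helper file `--supports stmt-NavierStokesRegularity-21220`;
route-independent (no `Theses` import).

THE OBJECT.  The numerically inhabited member of the ball-exact box class is the 2-filament `R_π` pair (kit j283832,
j284150, j287105; this seat's j289178/j289377): waist separation `d = 2/5` (waist units `X/√Γ`), tilt 45°, circulation
parameters `γ₁ = γ₂ = 4`, frame rotation `α = 21/5`, filament 2 the image of filament 1 under `(x,y,z) ↦ (−x,−y,z)`.  As
`Γ → ∞` its in-ball curvature (waist units) decays like `1/log Γ` (2.1, 1.5, 1.1, 0.9 at `Γ = 10⁴…10⁷`): the skeleton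
tends to the STRAIGHT skew pair through the same waist datum, the binormal self-induction `g κ log(1/κe)` staying `O(1)`
and absorbing the normal forcing.  This file certifies that straight limit configuration, AT EVERY `Γ ≥ 10⁴`, with the
regularised Biot–Savart field `u`, the frame velocity `v = u + ½y − α e₃ × y` and the tangential speed
`w = ⟪v(X₁ τ), X₁′ τ⟫` GIVEN BY THE BOX'S OWN DEFINING FORMULAS (hypotheses `hu hv` of `SelectionBoxRJ`, `N = 2`):

* `straightSkew_w_closed_form` — exact evaluation (self term ≡ 0 on a line; partner term by the closed Lorentzian line
  field `SkeletonEquilibrium.Sketch.stub_lineBiotSavart`):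
  `w(τ) = (4Γ√Γ/(5π)) / (4Γ/25 + 1 + τ²) + τ/2 − (21/25)(1/√2)√Γ`;
* `straightSkew_rung` — unit speed; separation `‖X₁ τ − X₂ σ‖ ≥ (2/5)√Γ`; tilt `|⟪X′_j, e₃⟫| ≤ 1 − 1/4`; parameter
  bounds with `θ₀ = 1/5`; `w` has EXACTLY ONE zero `c`, with `−(41/100)√Γ < c < −(39/100)√Γ`, waist `‖X₁ c‖ ≤ √Γ/2`,
  and SUPERCRITICAL slope `23/10 ≤ w′(c) ≤ 27/10` (inside `[3/2 + δ, Λ]` for `δ = 4/5`, `Λ = 27/10`).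

The finite-`Γ` exactly ball-tangent continuations of this datum have `c/√Γ = −0.327, −0.341, −0.351, −0.359` and
`w′(c) = 2.34, 2.40, 2.42, 2.43` at `Γ = 10⁴, 10⁵, 10⁶, 10⁷`, drifting toward the limit values certified here
(`c/√Γ ∈ (−0.41, −0.39)`, `w′(c) ≈ 2.49`) at the rate `1/log Γ`.

HONEST FRAMING.  NOT an instance of `SelectionBoxRJ`: straight filaments are never exactly tangent
(`TransverseReductionRStraight`, `StraightSkeleton.straight_box_absurd`); this is the `ε = 2/log Γ = 0` base point of
the rung's continuation argument (rung = exact ball tangency for one configuration and all `Γ ≥ Γ₂`: a computer-assisted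
IFT on the LIA-balance trajectory plus `Γ → ∞` asymptotics — not attempted here).  Nothing in this file is a claim about
Navier–Stokes regularity or blow-up.
-/

set_option linter.dupNamespace false

noncomputable section

namespace Summit.NavierStokesRegularity.NavierStokesRegularity.Theorems

open Set Function Filter MeasureTheory Real
open Literature.Analysis.FluidPDE
open scoped InnerProductSpace Topology

namespace SelectionBoxRJRung

/-- **Closed form of the box's tangential speed along straight filament 1.**  For the straight 2-filament datum at
circulation `Γ` (filament 1 through `(√Γ/5, 0, 0)` with tangent `(0, 1/√2, 1/√2)`, filament 2 its image under
`(x,y,z) ↦ (−x,−y,z)`, both with circulation parameter `γ = 4`), with `u`, `v`, `w` given by the formulas of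
`SelectionBoxRJ` (`N = 2`, `α = 21/5`): the self term vanishes, the partner term is the closed Lorentzian line field of
`SkeletonEquilibrium.Sketch.stub_lineBiotSavart`, and
`w(τ) = (4Γ√Γ/(5π)) / (4Γ/25 + 1 + τ²) + τ/2 − (21/25)(1/√2)√Γ`. [folklore] -/
theorem straightSkew_w_closed_form {Γ : ℝ} (hΓ : 0 ≤ Γ)
    (X : Fin 2 → ℝ → EuclideanSpace ℝ (Fin 3))
    (u : (Fin 2 → ℝ → EuclideanSpace ℝ (Fin 3)) → EuclideanSpace ℝ (Fin 3) → EuclideanSpace ℝ (Fin 3))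
    (v : EuclideanSpace ℝ (Fin 3) → EuclideanSpace ℝ (Fin 3)) (w : ℝ → ℝ)
    (hX0 : ∀ τ, X 0 τ = WithLp.toLp 2 ![Real.sqrt Γ / 5, 0, 0] + τ • WithLp.toLp 2 ![0, (Real.sqrt 2)⁻¹, (Real.sqrt 2)⁻¹])
    (hX1 : ∀ τ, X 1 τ = WithLp.toLp 2 ![-(Real.sqrt Γ / 5), 0, 0] + τ • WithLp.toLp 2 ![0, -(Real.sqrt 2)⁻¹, (Real.sqrt 2)⁻¹])
    (hu : ∀ Z y, u Z y = ∑ k : Fin 2, (Γ * 4 / (4 * Real.pi)) •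
      ∫ σ : ℝ, ((‖y - Z k σ‖ ^ 2 + 1) ^ (3 / 2 : ℝ))⁻¹ • cross (deriv (Z k) σ) (y - Z k σ))
    (hv : ∀ y, v y = u X y + (1 / 2 : ℝ) • y - (21 / 5 : ℝ) • cross (EuclideanSpace.single 2 1) y)
    (hw : ∀ τ, w τ = ⟪v (X 0 τ), deriv (X 0) τ⟫_ℝ) (τ : ℝ) :
    w τ = (4 * Γ * Real.sqrt Γ / (5 * Real.pi)) / (4 * Γ / 25 + 1 + τ ^ 2) + τ / 2
      - 21 / 25 * (Real.sqrt 2)⁻¹ * Real.sqrt Γ := by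
  have hs : (Real.sqrt 2)⁻¹ * (Real.sqrt 2)⁻¹ = 1 / 2 := inv_sqrt_two_mul_self
  have hG : Real.sqrt Γ * Real.sqrt Γ = Γ := Real.mul_self_sqrt hΓ
  have hXf0 : X 0 = fun τ => WithLp.toLp 2 ![Real.sqrt Γ / 5, 0, 0] + τ • WithLp.toLp 2 ![0, (Real.sqrt 2)⁻¹, (Real.sqrt 2)⁻¹] :=
    funext hX0
  have hXf1 : X 1 = fun τ => WithLp.toLp 2 ![-(Real.sqrt Γ / 5), 0, 0] + τ • WithLp.toLp 2 ![0, -(Real.sqrt 2)⁻¹, (Real.sqrt 2)⁻¹] :=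
    funext hX1
  -- the partner integral in closed form
  have hpart := (SkeletonEquilibrium.Sketch.stub_lineBiotSavart (WithLp.toLp 2 ![-(Real.sqrt Γ / 5), 0, 0])
    (WithLp.toLp 2 ![0, -(Real.sqrt 2)⁻¹, (Real.sqrt 2)⁻¹])
    (WithLp.toLp 2 ![Real.sqrt Γ / 5, 0, 0] + τ • WithLp.toLp 2 ![0, (Real.sqrt 2)⁻¹, (Real.sqrt 2)⁻¹]) norm_tangent₂).2
  have h1 : ⟪(WithLp.toLp 2 ![Real.sqrt Γ / 5, 0, 0] : EuclideanSpace ℝ (Fin 3)) + τ • WithLp.toLp 2 ![0, (Real.sqrt 2)⁻¹, (Real.sqrt 2)⁻¹]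
      - WithLp.toLp 2 ![-(Real.sqrt Γ / 5), 0, 0], WithLp.toLp 2 ![0, -(Real.sqrt 2)⁻¹, (Real.sqrt 2)⁻¹]⟫_ℝ = 0 := by
    rw [pt₁_sub_P₂, inner_vec3]; ring
  have h2 : ‖(WithLp.toLp 2 ![Real.sqrt Γ / 5, 0, 0] : EuclideanSpace ℝ (Fin 3)) + τ • WithLp.toLp 2 ![0, (Real.sqrt 2)⁻¹, (Real.sqrt 2)⁻¹]
      - WithLp.toLp 2 ![-(Real.sqrt Γ / 5), 0, 0]‖ ^ 2 = 4 * Γ / 25 + τ ^ 2 := by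
    rw [pt₁_sub_P₂, VortexFilament.norm_sq_toLp_three]; linear_combination (4 / 25) * hG + (2 * τ ^ 2) * hs
  have h3 : ⟪cross (WithLp.toLp 2 ![0, -(Real.sqrt 2)⁻¹, (Real.sqrt 2)⁻¹])
      ((WithLp.toLp 2 ![Real.sqrt Γ / 5, 0, 0] : EuclideanSpace ℝ (Fin 3)) + τ • WithLp.toLp 2 ![0, (Real.sqrt 2)⁻¹, (Real.sqrt 2)⁻¹]
        - WithLp.toLp 2 ![-(Real.sqrt Γ / 5), 0, 0]),
      (WithLp.toLp 2 ![0, (Real.sqrt 2)⁻¹, (Real.sqrt 2)⁻¹] : EuclideanSpace ℝ (Fin 3))⟫_ℝ = 2 * Real.sqrt Γ / 5 := by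
    rw [pt₁_sub_P₂, cross_vec3, inner_vec3]; linear_combination (4 * Real.sqrt Γ / 5) * hs
  have h4 : ⟪(WithLp.toLp 2 ![Real.sqrt Γ / 5, 0, 0] : EuclideanSpace ℝ (Fin 3)) + τ • WithLp.toLp 2 ![0, (Real.sqrt 2)⁻¹, (Real.sqrt 2)⁻¹],
      (WithLp.toLp 2 ![0, (Real.sqrt 2)⁻¹, (Real.sqrt 2)⁻¹] : EuclideanSpace ℝ (Fin 3))⟫_ℝ = τ := by
    rw [pt₁, inner_vec3]; linear_combination (2 * τ) * hs
  have h5 : ⟪cross (EuclideanSpace.single 2 1)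
      ((WithLp.toLp 2 ![Real.sqrt Γ / 5, 0, 0] : EuclideanSpace ℝ (Fin 3)) + τ • WithLp.toLp 2 ![0, (Real.sqrt 2)⁻¹, (Real.sqrt 2)⁻¹]),
      (WithLp.toLp 2 ![0, (Real.sqrt 2)⁻¹, (Real.sqrt 2)⁻¹] : EuclideanSpace ℝ (Fin 3))⟫_ℝ = Real.sqrt Γ / 5 * (Real.sqrt 2)⁻¹ := by
    rw [single_two_eq_vec3, pt₁, cross_vec3, inner_vec3]; ring
  -- the field u at the point of filament 1
  have hU : u X (X 0 τ) = (Γ * 4 / (4 * Real.pi)) • ((2 / (4 * Γ / 25 + τ ^ 2 + 1)) •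
      cross (WithLp.toLp 2 ![0, -(Real.sqrt 2)⁻¹, (Real.sqrt 2)⁻¹])
        ((WithLp.toLp 2 ![Real.sqrt Γ / 5, 0, 0] : EuclideanSpace ℝ (Fin 3)) + τ • WithLp.toLp 2 ![0, (Real.sqrt 2)⁻¹, (Real.sqrt 2)⁻¹]
          - WithLp.toLp 2 ![-(Real.sqrt Γ / 5), 0, 0])) := by
    rw [hu, Fin.sum_univ_two, hXf0, hXf1]
    simp only [deriv_line]
    rw [self_integral_zero, smul_zero, zero_add]
    rw [hpart, h2, h1]
    congr 2
    ring
  have hd : deriv (X 0) τ = WithLp.toLp 2 ![0, (Real.sqrt 2)⁻¹, (Real.sqrt 2)⁻¹] := by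
    rw [hXf0, deriv_line]
  rw [hw, hd, hv, hU, hX0, inner_sub_left, inner_add_left, inner_smul_left, inner_smul_left, h3, inner_smul_left,
    h4, inner_smul_left, h5]
  simp only [conj_trivial]
  have hD : 4 * Γ / 25 + τ ^ 2 + 1 ≠ 0 := by positivity
  have hD' : 4 * Γ / 25 + 1 + τ ^ 2 ≠ 0 := by positivity
  field_simp
  ring

set_option maxHeartbeats 400000 in
/-- **Rung 0 of `SelectionBoxRJ`: the straight-skew (`Γ → ∞`) limit of the 2-filament datum of record, certified with
the box's own objects.**  For every `Γ ≥ 10⁴`, with the straight skeleton `X`, its regularised Biot–Savart field `u`,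
frame velocity `v` and tangential speed `w` given by the defining formulas of `SelectionBoxRJ` (`N = 2`, `γ = 4`,
`α = 21/5`): unit speed; pairwise separation `≥ (2/5)√Γ`; tilt margin `|⟪X′_j, e₃⟫| ≤ 1 − 1/4`; parameter bounds with
`θ₀ = 1/5`; `w` has EXACTLY ONE zero `c`, located in `(−(41/100)√Γ, −(39/100)√Γ)`, with waist `‖X₁(c)‖ ≤ √Γ/2` and
SUPERCRITICAL slope `23/10 ≤ w′(c) ≤ 27/10`.  (Straight lines are not exactly tangent: this is the base point of the
rung's continuation argument, not an instance of the box; negative-side/constructive bookkeeping, nothing about NS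
regularity or blow-up.) [folklore] -/
theorem straightSkew_rung {Γ : ℝ} (hΓ : 10 ^ 4 ≤ Γ)
    (X : Fin 2 → ℝ → EuclideanSpace ℝ (Fin 3))
    (u : (Fin 2 → ℝ → EuclideanSpace ℝ (Fin 3)) → EuclideanSpace ℝ (Fin 3) → EuclideanSpace ℝ (Fin 3))
    (v : EuclideanSpace ℝ (Fin 3) → EuclideanSpace ℝ (Fin 3)) (w : ℝ → ℝ)
    (hX0 : ∀ τ, X 0 τ = WithLp.toLp 2 ![Real.sqrt Γ / 5, 0, 0] + τ • WithLp.toLp 2 ![0, (Real.sqrt 2)⁻¹, (Real.sqrt 2)⁻¹])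
    (hX1 : ∀ τ, X 1 τ = WithLp.toLp 2 ![-(Real.sqrt Γ / 5), 0, 0] + τ • WithLp.toLp 2 ![0, -(Real.sqrt 2)⁻¹, (Real.sqrt 2)⁻¹])
    (hu : ∀ Z y, u Z y = ∑ k : Fin 2, (Γ * 4 / (4 * Real.pi)) •
      ∫ σ : ℝ, ((‖y - Z k σ‖ ^ 2 + 1) ^ (3 / 2 : ℝ))⁻¹ • cross (deriv (Z k) σ) (y - Z k σ))
    (hv : ∀ y, v y = u X y + (1 / 2 : ℝ) • y - (21 / 5 : ℝ) • cross (EuclideanSpace.single 2 1) y)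
    (hw : ∀ τ, w τ = ⟪v (X 0 τ), deriv (X 0) τ⟫_ℝ) :
    (∀ j τ, ‖deriv (X j) τ‖ = 1) ∧
    (∀ τ σ, 2 / 5 * Real.sqrt Γ ≤ ‖X 0 τ - X 1 σ‖) ∧
    (∀ j τ, |⟪deriv (X j) τ, EuclideanSpace.single 2 1⟫_ℝ| ≤ 1 - 1 / 4) ∧
    ((1 / 5 : ℝ) ≤ |(21 / 5 : ℝ)| ∧ |(21 / 5 : ℝ)| ≤ (1 / 5)⁻¹ ∧ (1 / 5 : ℝ) ≤ |(4 : ℝ)| ∧ |(4 : ℝ)| ≤ (1 / 5)⁻¹) ∧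
    (∃! c : ℝ, w c = 0) ∧
    (∀ c : ℝ, w c = 0 →
      -(41 / 100) * Real.sqrt Γ < c ∧ c < -(39 / 100) * Real.sqrt Γ ∧ ‖X 0 c‖ ≤ Real.sqrt Γ / 2 ∧
      23 / 10 ≤ deriv w c ∧ deriv w c ≤ 27 / 10) := by
  have hΓ0 : 0 < Γ := by linarith [show (0:ℝ) < 10 ^ 4 by norm_num]
  have hG : 0 < Real.sqrt Γ := Real.sqrt_pos.mpr hΓ0
  have hG2 : Real.sqrt Γ ^ 2 = Γ := Real.sq_sqrt hΓ0.le
  have hs2 : (Real.sqrt 2)⁻¹ * (Real.sqrt 2)⁻¹ = 1 / 2 := inv_sqrt_two_mul_self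
  have hipos : 0 < (Real.sqrt 2)⁻¹ := by positivity
  obtain ⟨hb1, hb2⟩ := b_bounds hΓ
  set b : ℝ := 4 / 25 + 1 / Γ with hb
  have hbpos : 0 < b := by linarith
  have hXf0 : X 0 = fun τ => WithLp.toLp 2 ![Real.sqrt Γ / 5, 0, 0] + τ • WithLp.toLp 2 ![0, (Real.sqrt 2)⁻¹, (Real.sqrt 2)⁻¹] :=
    funext hX0
  have hXf1 : X 1 = fun τ => WithLp.toLp 2 ![-(Real.sqrt Γ / 5), 0, 0] + τ • WithLp.toLp 2 ![0, -(Real.sqrt 2)⁻¹, (Real.sqrt 2)⁻¹] :=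
    funext hX1
  -- w = √Γ · profile(τ/√Γ)
  have hwF : ∀ τ, w τ = Real.sqrt Γ *
      (4 / (5 * Real.pi) / (b + (τ / Real.sqrt Γ) ^ 2) + (τ / Real.sqrt Γ) / 2 - 21 / 25 * (Real.sqrt 2)⁻¹) := by
    intro τ
    rw [straightSkew_w_closed_form hΓ0.le X u v w hX0 hX1 hu hv hw τ, hb, div_pow, hG2]
    have hD : 4 * Γ / 25 + 1 + τ ^ 2 ≠ 0 := by positivity
    have hD2 : 4 / 25 + 1 / Γ + τ ^ 2 / Γ ≠ 0 := by positivity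
    field_simp
  have hwfun : w = fun τ => Real.sqrt Γ *
      (4 / (5 * Real.pi) / (b + (τ / Real.sqrt Γ) ^ 2) + (τ / Real.sqrt Γ) / 2 - 21 / 25 * (Real.sqrt 2)⁻¹) := funext hwF
  have hderiv : ∀ τ, HasDerivAt w (1 / 2 - 2 * (4 / (5 * Real.pi)) * (τ / Real.sqrt Γ) / (b + (τ / Real.sqrt Γ) ^ 2) ^ 2) τ := by
    intro τ; rw [hwfun]; exact hasDerivAt_profile hΓ0 b hbpos τ
  have hcont : Continuous w := continuous_iff_continuousAt.2 (fun t => (hderiv t).continuousAt)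
  -- zeros of w ↔ zeros of the profile at s = τ/√Γ
  have hzero_iff : ∀ τ, w τ = 0 ↔
      4 / (5 * Real.pi) / (b + (τ / Real.sqrt Γ) ^ 2) + (τ / Real.sqrt Γ) / 2 - 21 / 25 * (Real.sqrt 2)⁻¹ = 0 := by
    intro τ; rw [hwF]; constructor
    · intro h; rcases mul_eq_zero.mp h with h | h
      · exact absurd h hG.ne'
      · exact h
    · intro h; rw [h, mul_zero]
  have hmono := F_strictMonoOn hb1
  -- location of any zero
  have hloc : ∀ c, w c = 0 → -(41 / 100) * Real.sqrt Γ < c ∧ c < -(39 / 100) * Real.sqrt Γ := by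
    intro c hc
    rw [hzero_iff] at hc
    set s := c / Real.sqrt Γ with hs
    have hcs : c = s * Real.sqrt Γ := by rw [hs]; field_simp
    have hsneg : s < 0 := by
      by_contra h; rw [not_lt] at h
      have := F_pos_of_nonneg hb1 hb2 h; linarith
    have h41 : -41 / 100 < s := by
      by_contra h; rw [not_lt] at h
      have hle : 4 / (5 * Real.pi) / (b + s ^ 2) + s / 2 - 21 / 25 * (Real.sqrt 2)⁻¹ ≤
          4 / (5 * Real.pi) / (b + (-41 / 100 : ℝ) ^ 2) + (-41 / 100 : ℝ) / 2 - 21 / 25 * (Real.sqrt 2)⁻¹ := by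
        rcases h.lt_or_eq with h' | h'
        · exact (hmono (by simp [mem_Iic]; linarith) (by simp [mem_Iic]; norm_num) h').le
        · rw [h']
      have := F_neg hb1; linarith
    have h39 : s < -39 / 100 := by
      by_contra h; rw [not_lt] at h
      have hle : 4 / (5 * Real.pi) / (b + (-39 / 100 : ℝ) ^ 2) + (-39 / 100 : ℝ) / 2 - 21 / 25 * (Real.sqrt 2)⁻¹ ≤
          4 / (5 * Real.pi) / (b + s ^ 2) + s / 2 - 21 / 25 * (Real.sqrt 2)⁻¹ := by
        rcases h.lt_or_eq with h' | h'
        · exact (hmono (by simp [mem_Iic]; norm_num) (by simp [mem_Iic]; linarith) h').le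
        · rw [h']
      have := F_pos hb1 hb2; linarith
    constructor <;> [rw [hcs]; rw [hcs]] <;> nlinarith
  refine ⟨?_, ?_, ?_, ?_, ?_, ?_⟩
  · -- unit speed
    intro j τ
    fin_cases j
    · simp only [Fin.zero_eta]; rw [hXf0, deriv_line]; exact norm_tangent₁
    · simp only [Fin.mk_one]; rw [hXf1, deriv_line]; exact norm_tangent₂
  · -- separation
    intro τ σ
    have hdiff : X 0 τ - X 1 σ =
        WithLp.toLp 2 ![2 * Real.sqrt Γ / 5, (τ + σ) * (Real.sqrt 2)⁻¹, (τ - σ) * (Real.sqrt 2)⁻¹] := by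
      rw [hX0, hX1, smul_vec3, smul_vec3, add_vec3, add_vec3, sub_vec3]
      congr 1
      funext i
      fin_cases i
      · simp; ring
      · simp; ring
      · simp; ring
    have hsq : (2 / 5 * Real.sqrt Γ) ^ 2 ≤ ‖X 0 τ - X 1 σ‖ ^ 2 := by
      rw [hdiff, VortexFilament.norm_sq_toLp_three]; nlinarith [sq_nonneg ((τ + σ) * (Real.sqrt 2)⁻¹), sq_nonneg ((τ - σ) * (Real.sqrt 2)⁻¹)]
    have hn : 0 ≤ ‖X 0 τ - X 1 σ‖ := norm_nonneg _
    by_contra h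
    rw [not_le] at h
    nlinarith [hsq, hn, h, hG]
  · -- tilt margin θ₀ = 1/4
    have hi34 : (Real.sqrt 2)⁻¹ ≤ 3 / 4 := by nlinarith [hs2, hipos]
    intro j τ
    fin_cases j
    · simp only [Fin.zero_eta]
      rw [hXf0, deriv_line, EuclideanSpace.inner_single_right]
      have h34 : (1:ℝ) - 1 / 4 = 3 / 4 := by norm_num
      rw [h34]
      simpa [abs_of_pos hipos, abs_of_pos (Real.sqrt_pos.mpr (by norm_num : (0:ℝ) < 2))] using hi34
    · simp only [Fin.mk_one]
      rw [hXf1, deriv_line, EuclideanSpace.inner_single_right]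
      have h34 : (1:ℝ) - 1 / 4 = 3 / 4 := by norm_num
      rw [h34]
      simpa [abs_of_pos hipos, abs_of_pos (Real.sqrt_pos.mpr (by norm_num : (0:ℝ) < 2))] using hi34
  · -- parameter bounds θ₀ = 1/5 ≤ |α|, |γ| ≤ θ₀⁻¹
    norm_num
  · -- existence and uniqueness of the zero
    have ha : w (-(41 / 100) * Real.sqrt Γ) < 0 := by
      rw [hwF]
      have : -(41 / 100) * Real.sqrt Γ / Real.sqrt Γ = -41 / 100 := by field_simp
      rw [this]
      have := F_neg hb1
      nlinarith
    have hbpos' : 0 < w (-(39 / 100) * Real.sqrt Γ) := by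
      rw [hwF]
      have : -(39 / 100) * Real.sqrt Γ / Real.sqrt Γ = -39 / 100 := by field_simp
      rw [this]
      have := F_pos hb1 hb2
      nlinarith
    have hab : -(41 / 100) * Real.sqrt Γ ≤ -(39 / 100) * Real.sqrt Γ := by nlinarith
    obtain ⟨c, _, hc⟩ := intermediate_value_Ioo hab hcont.continuousOn ⟨ha, hbpos'⟩
    refine ⟨c, hc, ?_⟩
    intro c' hc'
    have h1 := (hzero_iff c).1 hc
    have h2 := (hzero_iff c').1 hc'
    have hs1 : c / Real.sqrt Γ < 0 := by
      have := (hloc c hc).2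
      rw [div_lt_iff₀ hG]; nlinarith [this, hG]
    have hs2' : c' / Real.sqrt Γ < 0 := by
      have := (hloc c' hc').2
      rw [div_lt_iff₀ hG]; nlinarith [this, hG]
    rcases lt_trichotomy (c' / Real.sqrt Γ) (c / Real.sqrt Γ) with hlt | heq | hgt
    · have hm := hmono (show c' / Real.sqrt Γ ∈ Iic (0:ℝ) from hs2'.le) (show c / Real.sqrt Γ ∈ Iic (0:ℝ) from hs1.le) hlt
      dsimp only at hm
      rw [h1, h2] at hm
      exact absurd hm (lt_irrefl 0)
    · exact (div_left_inj' hG.ne').mp heq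
    · have hm := hmono (show c / Real.sqrt Γ ∈ Iic (0:ℝ) from hs1.le) (show c' / Real.sqrt Γ ∈ Iic (0:ℝ) from hs2'.le) hgt
      dsimp only at hm
      rw [h1, h2] at hm
      exact absurd hm (lt_irrefl 0)
  · -- location, waist and slope window at the zero
    intro c hc
    obtain ⟨hc1, hc2⟩ := hloc c hc
    refine ⟨hc1, hc2, ?_, ?_⟩
    · have hsq : ‖X 0 c‖ ^ 2 ≤ (Real.sqrt Γ / 2) ^ 2 := by
        rw [hX0, pt₁, VortexFilament.norm_sq_toLp_three]
        have hc2' : c ^ 2 ≤ (41 / 100) ^ 2 * Real.sqrt Γ ^ 2 := by nlinarith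
        nlinarith [hs2]
      have hn : 0 ≤ ‖X 0 c‖ := norm_nonneg _
      by_contra h
      rw [not_le] at h
      nlinarith [hsq, hn, h, hG]
    · have hs1 : -41 / 100 ≤ c / Real.sqrt Γ := by rw [le_div_iff₀ hG]; linarith [hc1]
      have hs2' : c / Real.sqrt Γ ≤ -39 / 100 := by rw [div_le_iff₀ hG]; linarith [hc2]
      rw [(hderiv c).deriv]
      exact Fderiv_window hb1 hb2 hs1 hs2'

end SelectionBoxRJRung

end Summit.NavierStokesRegularity.NavierStokesRegularity.Theorems
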